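/-
Copyright (c) 2026 the pub-hodgecm-mathlib formalisation cell (harness21).  R90-TF SLAB, section S10 (Rogawski 1990, §13.8 Prop. 13.8.3 read at `v`),
prover K2E3-p12 (g11) — DEAL #90 (S10 dealer R90-C138-plan (g4), 2026-09-05T03:39:41Z): A2c CENSUS-THEN-ASSEMBLER; h413 = `stmt-HodgeConjecture-24833`, route `HCCMUnconditional`.
-/
import Summits.HodgeConjecture.HodgeConjecture.Theorems.R90S10UnitFLDyadicUnrLetterDefs   -- ★ W1-H8 (R90-C138-p07): `UnitFLDyadicUnrLetter`, `hFL₂_of_unitFLDyadicUnr`; brings ★ p863333 `frozenPinned_of_unitTransfer` (A2c♯'s payer)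
import HarnessLib

/-!
# R90-TF ∕ S10 — A2c♭: THE FROZEN VECTOR OF (13.8.3) EXISTS FOR EVERY ARCHIMEDEAN-REGULAR `H`-DATUM, modulo only the EXT letter «(E1-c♭)»
# (`Theorems/R90S10FrozenVectorsOfLetters.lean`; ns `Summit.HodgeConjecture.HodgeConjecture.R90.S10`; the honest assembler behind Lines A's socket A2c `sock_S10_frozenVectors`)

Lines A (`Cruxes/H413/Lines/R90_S10_SimpleTF1383A.lean`) §3 socket A2c `sock_S10_frozenVectors` asks `∀ 𝔥 : S10HDatum …, Nonempty (S10Frozen … 𝔥)` under ⟪P⟫ ⟪U⟫ `h3` ⟪I⟫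
— for EVERY datum, with ★ `S10HDatum`'s archimedean line character `χi : H1Arch L → ℂ` and its measure `ν₁i` left BARE.  Audit N16 ∕ RULING J-A2c-3: not payable as typed (the
`θ_∞`-reduction `fHi₂ h₂ = ∫ f^H_∞(h₂, z) χi(z) dν₁i`, the archimedean factor of the `C_c` pure tensor `ΦH f^H`, is continuous only for archimedean-REGULAR data), and the regularity
clause `Continuous 𝔥.χi ∧ IsFiniteMeasureOnCompacts 𝔥.ν₁i` is NOT a consequence of `S10HDatum`'s fields (`hθi`, `hpacki` see `χi` only under `∫ … ∂ν₁i`, so altering `χi` on one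
point keeps every field law and breaks continuity) — hence it cannot be a LETTER quantified over all `𝔥` either.  WHAT IS PAYABLE, and is paid here (DEAL #90 census
`K2/K2E3-p12/g11/CENSUS-DEAL90-A2c.md`): **A2c♭ `frozenVectors_of_unitFLDyadicUnr_of_archRegular`** — A2c's statement VERBATIM up to its last line, which becomes
`UnitFLDyadicUnrLetter L μ v → ∀ 𝔥, (Continuous 𝔥.χi ∧ IsFiniteMeasureOnCompacts 𝔥.ν₁i) → Nonempty (S10Frozen … 𝔥)`: the two residual inputs are NAMED and CLASSED —
(EXT) ★ `UnitFLDyadicUnrLetter L μ v` (W1-H8; = Lines A's listed EXT socket `stub_R90_ext_unitFL₂ L μ v hμu hμq`, the dyadic inert unit fundamental lemma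
[Rogawski1990, §4.9 Prop. 4.9.1 (b) p. 55; BlasiusRogawski1992, Thm. 1]) and (REG, per datum) archimedean regularity, which the ★ constructor of record ★ `realiseH_of_globalPacket`
(`Theorems/R90S10HDatumOfGlobalPacket.lean` :76) DELIVERS for the data it builds (its outputs carry `Continuous 𝔥.χi ∧ IsFiniteMeasureOnCompacts 𝔥.ν₁i` from the named
inputs `hχi`, `[IsFiniteMeasureOnCompacts ν₁i]`).  PROOF: the archimedean pair is NOT a further input — it is the FIELD `𝔥.harch` of ★ `S10HDatum` (the six archimedean laws of
★ `S10Frozen` as one ∃-clause: smooth, smooth, `Δ″_∞`-transfer at `archDeltaPP L μ`, stably null, packet trace `2`, sign test); feed it to ★ p863333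
`frozenPinned_of_unitTransfer` (A2c♯'s payer) with `hFL₂ := hFL₂_of_unitFLDyadicUnr L μ v hUFL hunr`.  So A2c♭ is the one-place twin of Lines A's PROVED ₂-glue
`frozenVectors₂_of_pinned` (l.852), and Lines A's ₁-road `frozenDatum_of_sockets` (l.583) can call it at any arch-regular `𝔥` instead of A2c; A2c itself (l.332, no regularity
clause, byte-frozen) stays the catalogued negative edge N16, OFF the path of HEAD₂∕HEAD₃ of record (which run on the ₂-road through `frozenVectors₂_of_pinned`).
THEOREMS ONLY — no `def`, no instance, no notation, no Lines import, no `sorry`; ★-only imports.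

HONEST LABEL: HC_CM is proved only modulo the 7 printed citations (2 remaining named inputs: hLiu418 = `stmt-HodgeConjecture-24832`, h413 = `stmt-HodgeConjecture-24833`) until rung
0 closes.  A2c♭ is CONDITIONAL on the EXT letter (a printed citation, not a proof) and on per-datum archimedean regularity; it discharges no socket and does not claim A2c
(REL ≠ ★ ≠ WRITTEN ≠ BUILT); count-neutral.

[cite: Rogawski1990, §13.8 Prop. 13.8.3 (proof) p. 218 L20–L28, p. 219 L1–L3; §4.9 Prop. 4.9.1 (b) p. 55] [cite: BlasiusRogawski1992, Thm. 1] [cite: FlathCorvallis1979, Thm. 3]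
-/

set_option autoImplicit false
set_option linter.dupNamespace false

noncomputable section

open scoped RestrictedProduct Matrix MatrixGroups
open Filter MeasureTheory Measure NumberField IsDedekindDomain CompactlySupported Topology Set
open Literature.NumberTheory.Rogawski1990 Literature.NumberTheory.Automorphic Literature.NumberTheory.Automorphic.UnitaryGroup
open Literature.NumberTheory.Automorphic.UnitaryGroup.CotangentForms Literature.NumberTheory.GaloisRepresentations
open Literature.NumberTheory.Automorphic.Arthur2013.Leaves.TECR
open Summit.HodgeConjecture.HodgeConjecture.Cruxes.H413.K2E1TraceFormulaBeta
open Summit.HodgeConjecture.HodgeConjecture.Cruxes.H413.K2E1SpectralTermsDiscreteHalf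

namespace Summit.HodgeConjecture.HodgeConjecture.R90.S10

/-! ## A2c♭ — the frozen vector for every archimedean-regular datum, modulo the EXT letter -/

/-- **A2c♭ — `frozenVectors_of_unitFLDyadicUnr_of_archRegular`: THE FROZEN TEST VECTOR AND ITS `H`-TRANSFER EXIST FOR EVERY ARCHIMEDEAN-REGULAR `H`-DATUM.**  Under ⟪P⟫ ⟪U⟫ `h3` ⟪I⟫
(Lines A's socket A2c `sock_S10_frozenVectors` binders l.333–361 VERBATIM), GIVEN the EXT letter ★ `UnitFLDyadicUnrLetter L μ v` («(E1-c♭)», the unit fundamental lemma at the dyadic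
inert unramified `w ≠ v` [Prop. 4.9.1 (b)]): for every `𝔥 : S10HDatum …` with `Continuous 𝔥.χi ∧ IsFiniteMeasureOnCompacts 𝔥.ν₁i` («`θ_∞` continuous, `dz` Haar», p. 219 L1–L2),
`S10Frozen … 𝔥` is inhabited — ★ A2c♯'s payer `frozenPinned_of_unitTransfer` at the archimedean pair of the FIELD `𝔥.harch` (`f_∞ → f_∞^H` a `Δ″_∞`-transfer, `f_∞` stably null with
the sign test, packet trace `2`; p. 218 L20–L28).  A2c's last line `∀ 𝔥, Nonempty (S10Frozen … 𝔥)` WITHOUT the regularity clause is NOT claimed (negative edge N16).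
[cite: Rogawski1990, §13.8 Prop. 13.8.3 (proof) p. 218 L20–L28, p. 219 L1–L3; §4.9 Prop. 4.9.1 (b) p. 55] [cite: BlasiusRogawski1992, Thm. 1] [cite: FlathCorvallis1979, Thm. 3] -/
theorem frozenVectors_of_unitFLDyadicUnr_of_archRegular :
    ∀ (L : Type) [Field L] [NumberField L] [IsCMField L] (μ : HeckeCharacter L) (ξ : OneDimAutRepH L) (v : Pl L),
      (∀ w : PlacesOver L v, IsCMField.complexConj L • w.1 = w.1) → μ.IsUnitary →
      (∀ x : Literature.NumberTheory.GaloisRepresentations.ideleGroup ↥(maximalRealSubfield L),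
        μ (AdeleRing.ideleBaseChange (↥(maximalRealSubfield L)) L x) = quadraticHeckeCharCM L x) →
      (∀ w : Pl L, w ≠ v → ∀ W : PlacesOver L w, Algebra.IsUnramifiedAt (𝓞 ↥(maximalRealSubfield L)) W.1.asIdeal ∧ μ.IsUnramifiedAt W.1) →
      (3 ≤ Module.finrank ℚ ↥(maximalRealSubfield L)) →
      ∀ [MeasurableSpace (HLoc L v)] [BorelSpace (HLoc L v)] [MeasurableSpace (Gqs L v)] [BorelSpace (Gqs L v)]
        (νHv : Measure (HLoc L v)) (νQv : Measure (Gqs L v))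
        [νHv.IsHaarMeasure] [νHv.IsMulRightInvariant] [νQv.IsHaarMeasure] [νQv.IsMulRightInvariant],
      letI : ∀ a : HLoc L v, MeasurableSpace (HLoc L v ⧸ Subgroup.centralizer ({a} : Set (HLoc L v))) := fun _ => borel _
      haveI : ∀ a : HLoc L v, BorelSpace (HLoc L v ⧸ Subgroup.centralizer ({a} : Set (HLoc L v))) := fun _ => ⟨rfl⟩
      letI : ∀ γ : Gqs L v, MeasurableSpace (Gqs L v ⧸ Subgroup.centralizer ({γ} : Set (Gqs L v))) := fun _ => borel _
      haveI : ∀ γ : Gqs L v, BorelSpace (Gqs L v ⧸ Subgroup.centralizer ({γ} : Set (Gqs L v))) := fun _ => ⟨rfl⟩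
      ∀ (mHv : OrbitalMeasureFamily (HLoc L v)) (mQv : OrbitalMeasureFamily (Gqs L v)),
        mHv.IsCanonical (IsLocalGRegular L v) νHv →
        mQv.IsCanonical (fun γ => IsRegularElt (γ.val : GL (Fin 3) (UnitaryGroup.LocalRing L v))) νQv →
        ∀ (π₁ πSt : IrrClass (HLoc L v)),
          HLengthTwoLabels L v
            (torusCharPair (conjLocal L (IsCMField.complexConj L) v) (cmLocalForm L 2 v) (cmLocalForm_eq_over L 2 v) 0
              ((torusLocalComponent L (IsCMField.complexConj L) v ξ.η).comp
                  (quotConj (conjLocal L (IsCMField.complexConj L) v) (conjLocal_conjLocal_cm L v)) *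
                halfModulusChar (UnitaryGroup.LocalRing L v))
              (torusLocalComponent L (IsCMField.complexConj L) v ξ.ψ))
            ((torusLocalComponent L (IsCMField.complexConj L) v ξ.ψ).comp (localDet (IsCMField.complexConj L) v (isUnit_antidiagOne_det L 1))) π₁ πSt →
          (∀ fH : HLoc L v → ℂ, IsLocSmooth fH → π₁.smoothTrace νHv fH = charDist (ξ.xiLocalChar v) νHv fH) →
          ∀ [DecidableEq (Pl L)] [MeasurableSpace (G3 L).Adelic] [BorelSpace (G3 L).Adelic] [MeasurableSpace (H2 L).Adelic] [BorelSpace (H2 L).Adelic]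
            [MeasurableSpace (GArch L)] [BorelSpace (GArch L)] [MeasurableSpace (HArch L)] [BorelSpace (HArch L)]
            [MeasurableSpace (H1Loc L v)] [BorelSpace (H1Loc L v)] [MeasurableSpace (H1Arch L)] [BorelSpace (H1Arch L)]
            [MeasurableSpace (H1 L).Adelic] [BorelSpace (H1 L).Adelic],
          UnitFLDyadicUnrLetter L μ v →
          ∀ 𝔥 : S10HDatum L μ v νHv νQv mHv mQv πSt, (Continuous 𝔥.χi ∧ IsFiniteMeasureOnCompacts 𝔥.ν₁i) →
            Nonempty (S10Frozen L μ v νHv νQv mHv mQv πSt 𝔥) := by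
  intro L _ _ _ μ ξ v hv hμu hμq hunr h3 _ _ _ _ νHv νQv _ _ _ _ mHv mQv hmH hmQ π₁ πSt hlab hπ₁ _ _ _ _ _ _ _ _ _ _ _ _ _ _ _ hUFL 𝔥 hreg
  -- re-install the letter's quotient σ-algebras at `v` as local instances (definitionally the `letI`s of the statement), as ★ p863333 does
  letI : ∀ a : HLoc L v, MeasurableSpace (HLoc L v ⧸ Subgroup.centralizer ({a} : Set (HLoc L v))) := fun _ => borel _
  haveI : ∀ a : HLoc L v, BorelSpace (HLoc L v ⧸ Subgroup.centralizer ({a} : Set (HLoc L v))) := fun _ => ⟨rfl⟩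
  letI : ∀ γ : Gqs L v, MeasurableSpace (Gqs L v ⧸ Subgroup.centralizer ({γ} : Set (Gqs L v))) := fun _ => borel _
  haveI : ∀ γ : Gqs L v, BorelSpace (Gqs L v ⧸ Subgroup.centralizer ({γ} : Set (Gqs L v))) := fun _ => ⟨rfl⟩
  -- the archimedean pair and its six laws are the FIELD `𝔥.harch` of the datum
  obtain ⟨fG, fH, hsmG, hsmH, htr, hSO, hop, hsign⟩ := 𝔥.harch
  obtain ⟨𝔳, -, -⟩ := frozenPinned_of_unitTransfer L μ ξ v hv hμu hμq hunr h3 νHv νQv mHv mQv hmH hmQ π₁ πSt hlab hπ₁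
    (hFL₂_of_unitFLDyadicUnr L μ v hUFL hunr) 𝔥 hreg fG fH hsmG hSO hsign hsmH htr hop
  exact ⟨𝔳⟩

end Summit.HodgeConjecture.HodgeConjecture.R90.S10

end
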